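import Summits.CriticalPhenomena.PercolationContinuityZ3.Theorems.PercExchangeRateTransportModelFactsStubPushforward
import Literature.Probability.Percolation.SharpnessDCTProofs
import Literature.Probability.Percolation.LatticeSymmetry
import Mathlib.Analysis.Calculus.TangentCone.Real

/-!
# `SubcritExchangeUniformity` (K⁻, crux stmt-CriticalPhenomena-16062, route `PercExchangeRateTransport`),
# negative lane, part 0: the crux's objects named, the product form, the half-plane `{p ≤ 0}`

Support DEFINITIONS and elementary lemmas for the crux disprover's negative lane (cdisprove,
cycle 1); nothing here asserts a Theses decl. This is the only file of the lane that declares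
definitions (review-queued by D-0009); the theorem files `VerticalRusso`, `CutoffGuard`,
`DiagonalIdentity` of the same directory import it and declare none.

* §0 the crux's own `let`-objects, named verbatim: `vertBonds` (membership = the crux's `vert e`,
  `Iff.rfl`), `cfgPT` (= `cfg`), `ThetaBox` (= `Θ`), `thetaPerc` (= `θ`), `pcurve` (= `pc`);
  `pcurve_nonneg`.
* §1 the push-forward ONCE to the tree's inhomogeneous product measure: threshold field `τPT`,
  parameter field `param p t = E(ℤ³).indicator (projIcc ∘ τPT p t)`, and
  `ThetaBox_eq : Θ_n(p,t) = (prodBernoulli (param p t)).real {0 ↔ ∂Λ_n}` from the landed keystone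
  `ModelFacts.stub_pushforward`.
* §2 the degenerate half-plane: for `p ≤ 0` the clamp `projIcc 0 1 p = 0` kills every horizontal
  bond, `param p t = param 0 t`, `Θ_n(p,t) = Θ_n(0,t)`, and Mathlib's
  `deriv (fun q => Θ_n(q,t)) p = 0` for EVERY `p ≤ 0` (`deriv_p_eq_zero_of_nonpos`; at the corner
  `p = 0` by uniqueness of derivatives within `Iic 0`, or junk `0` if the slice is not differentiable).
* §3 names used downstream: the column geometry (`Column.*`, first vertical bond `Column.ez = s(0,e₃)`,
  the column `Column.colT n`), the vertical Russo weights `wz`, the direction-`i` bonds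
  `Diag.dirBonds i` with `Diag.wdir i`, `Diag.wh`, and the unsigned coordinate permutations
  `Diag.permIso π = zdSignedPermIso π 1` with the induced pair bijection `Diag.pairPerm π`.

Tree lemmas used: `ModelFacts.stub_pushforward`, `DCT16.measurableSet_siteToBoundary`,
`DCT16.mem_innerBoundary_box_of_natAbs_eq`, `zdSignedPermIso`, `sym2Equiv`; Mathlib `uniqueDiffOn_Iic`,
`UniqueDiffWithinAt.eq_deriv`, `deriv_zero_of_not_differentiableAt`.
-/

noncomputable section

namespace Summit.CriticalPhenomena.PercolationContinuityZ3.Theorems.SubcritExchangeUniformity.Negative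

open MeasureTheory Filter Topology
open Literature.Probability.Percolation Literature.Probability.LatticeModels
open Literature.Probability.Percolation.DCT16

/-! ## §0 The crux's objects, named (same text as the `let`s of `SubcritExchangeUniformity`) -/

/-- The set of vertical (`z`-) bonds `{x, x + e₃}` (membership is the crux's `vert e`, by `Iff.rfl`).
[folklore] -/
def vertBonds : Set (Sym2 (Site 3)) := {e | ∃ x : Site 3, e = s(x, x + Pi.single (2 : Fin 3) 1)}

/-- Membership in `vertBonds` is the crux's `vert`. [folklore] -/
theorem mem_vertBonds_iff (e : Sym2 (Site 3)) :
    e ∈ vertBonds ↔ ∃ x : Site 3, e = s(x, x + Pi.single (2 : Fin 3) 1) := Iff.rfl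

/-- The label-coupled anisotropic configuration at `(p,t)` (the crux's `cfg`). [folklore] -/
def cfgPT (p t : ℝ) (U : Sym2 (Site 3) → ℝ) : Set (Sym2 (Site 3)) :=
  {e | e ∈ (zdGraph 3).edgeSet ∧ ((e ∈ vertBonds ∧ U e ≤ t) ∨ (e ∉ vertBonds ∧ U e ≤ p))}

/-- `Θ_n(p,t) = P(0 ↔ ∂Λ_n in Λ_n)` (the crux's `Θ`). [folklore] -/
def ThetaBox (n : ℕ) (p t : ℝ) : ℝ :=
  (labelMeasure (Site 3)).real {U | cfgPT p t U ∈ siteToBoundary 3 n}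

/-- `θ(p,t) = P(|C(0)| = ∞)` (the crux's `θ`). [folklore] -/
def thetaPerc (p t : ℝ) : ℝ :=
  (labelMeasure (Site 3)).real {U | cfgPT p t U ∈ percolatesAt (0 : Site 3)}

/-- The anisotropic critical curve `p_c(t)` (the crux's `pc`). [folklore] -/
def pcurve (t : ℝ) : ℝ := sInf ({p : ℝ | 0 ≤ p ∧ p ≤ 1 ∧ 0 < thetaPerc p t} ∪ {1})

/-- `0 ≤ p_c(t)` for every real `t` (the defining set lies in `[0,1]`). [folklore] -/
theorem pcurve_nonneg (t : ℝ) : 0 ≤ pcurve t := by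
  refine le_csInf ⟨1, Or.inr rfl⟩ ?_
  rintro q (⟨hq, -⟩ | hq)
  · exact hq
  · rw [Set.mem_singleton_iff] at hq
    rw [hq]
    exact zero_le_one

/-! ## §1 Transfer to the tree's inhomogeneous product measure `prodBernoulli` -/

open Classical in
/-- The threshold field of the family: `t` on vertical bonds, `p` elsewhere. [folklore] -/
def τPT (p t : ℝ) (e : Sym2 (Site 3)) : ℝ := if e ∈ vertBonds then t else p

/-- The parameter field: `projIcc 0 1 (τ p t e)` on `E(ℤ³)`, `0` off it. [folklore] -/
def param (p t : ℝ) : Sym2 (Site 3) → unitInterval :=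
  (zdGraph 3).edgeSet.indicator fun e => Set.projIcc (0 : ℝ) 1 zero_le_one (τPT p t e)

/-- The threshold on a vertical bond is `t`. [folklore] -/
theorem τPT_of_vert {e : Sym2 (Site 3)} (h : e ∈ vertBonds) (p t : ℝ) : τPT p t e = t := by
  simp [τPT, h]

/-- The threshold on a non-vertical pair is `p`. [folklore] -/
theorem τPT_of_not_vert {e : Sym2 (Site 3)} (h : e ∉ vertBonds) (p t : ℝ) : τPT p t e = p := by
  simp [τPT, h]

/-- The parameter of a lattice edge is the clamped threshold. [folklore] -/
theorem param_of_mem {e : Sym2 (Site 3)} (he : e ∈ (zdGraph 3).edgeSet) (p t : ℝ) :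
    param p t e = Set.projIcc (0 : ℝ) 1 zero_le_one (τPT p t e) :=
  Set.indicator_of_mem he _

/-- The parameter of a non-edge is `0`. [folklore] -/
theorem param_of_not_mem {e : Sym2 (Site 3)} (he : e ∉ (zdGraph 3).edgeSet) (p t : ℝ) :
    param p t e = 0 :=
  Set.indicator_of_notMem he _

/-- `cfgPT p t` is thresholding at the field `τPT p t`. [folklore] -/
theorem cfgPT_eq_fun (p t : ℝ) :
    cfgPT p t = fun U : Sym2 (Site 3) → ℝ => {e | e ∈ (zdGraph 3).edgeSet ∧ U e ≤ τPT p t e} := by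
  funext U
  ext e
  simp only [cfgPT, Set.mem_setOf_eq]
  by_cases h : e ∈ vertBonds
  · rw [τPT_of_vert h]; tauto
  · rw [τPT_of_not_vert h]; tauto

/-- Thresholding maps are measurable. [folklore] -/
theorem measurable_cfgPT (p t : ℝ) : Measurable (cfgPT p t) := by
  rw [cfgPT_eq_fun]
  exact measurable_set_iff.2 fun e =>
    (show Measurable fun s : ℝ => (e ∈ (zdGraph 3).edgeSet ∧ s ≤ τPT p t e) from
      measurable_const.and (measurableSet_setOf.1 measurableSet_Iic)).comp (measurable_pi_apply e)

/-- **The push-forward of the family** (landed keystone `ModelFacts.stub_pushforward`):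
the law of `cfgPT p t` under the i.i.d. uniform labels is `prodBernoulli (param p t)`. [folklore] -/
theorem map_cfgPT (p t : ℝ) : (labelMeasure (Site 3)).map (cfgPT p t) = prodBernoulli (param p t) := by
  rw [cfgPT_eq_fun]
  exact Summit.CriticalPhenomena.PercolationContinuityZ3.Theorems.ModelFacts.stub_pushforward _ _

/-- `Θ_n(p,t)` is the `prodBernoulli (param p t)`-probability of `{0 ↔ ∂Λ_n}`. [folklore] -/
theorem ThetaBox_eq (n : ℕ) (p t : ℝ) :
    ThetaBox n p t = (prodBernoulli (param p t)).real (siteToBoundary 3 n) := by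
  rw [ThetaBox, ← map_cfgPT p t, measureReal_def, measureReal_def,
    Measure.map_apply (measurable_cfgPT p t) (measurableSet_siteToBoundary 3 n)]
  rfl

/-! ## §2 The half-plane `{p ≤ 0}`: the family is constant in `p`, so `∂_pΘ_n = 0` there -/

/-- On `{p ≤ 0}` the parameter field is that of `p = 0` (the clamp `projIcc 0 1 p = 0`). [folklore] -/
theorem param_of_nonpos {p : ℝ} (hp : p ≤ 0) (t : ℝ) : param p t = param 0 t := by
  funext e
  by_cases he : e ∈ (zdGraph 3).edgeSet
  · rw [param_of_mem he, param_of_mem he]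
    by_cases hv : e ∈ vertBonds
    · rw [τPT_of_vert hv, τPT_of_vert hv]
    · rw [τPT_of_not_vert hv, τPT_of_not_vert hv, Set.projIcc_of_le_left _ hp, Set.projIcc_left]
  · rw [param_of_not_mem he, param_of_not_mem he]

/-- **`Θ_n(p,t) = Θ_n(0,t)` for `p ≤ 0`**: below `p = 0` no horizontal bond is open, the model is
"vertical-only" and does not see `p`. [folklore] -/
theorem ThetaBox_of_nonpos (n : ℕ) {p : ℝ} (hp : p ≤ 0) (t : ℝ) : ThetaBox n p t = ThetaBox n 0 t := by
  rw [ThetaBox_eq, ThetaBox_eq, param_of_nonpos hp]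

/-- **`∂_pΘ_n(p,t) = 0` for every `p ≤ 0`** (Mathlib's `deriv`, as in the crux): the `p`-slice is
constant on `(-∞, 0]`, so at `p < 0` the derivative is `0`, and at the corner `p = 0` either the
slice is differentiable (then its derivative is the left one, `0`, by uniqueness of derivatives
within `Iic 0`) or it is not (then `deriv` is `0` by convention). [folklore] -/
theorem deriv_p_eq_zero_of_nonpos (n : ℕ) (t : ℝ) {p : ℝ} (hp : p ≤ 0) :
    deriv (fun q => ThetaBox n q t) p = 0 := by
  by_cases hd : DifferentiableAt ℝ (fun q => ThetaBox n q t) p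
  · have h1 : HasDerivWithinAt (fun q => ThetaBox n q t) (deriv (fun q => ThetaBox n q t) p)
        (Set.Iic 0) p :=
      hd.hasDerivAt.hasDerivWithinAt
    have h2 : HasDerivWithinAt (fun q => ThetaBox n q t) 0 (Set.Iic 0) p :=
      (hasDerivWithinAt_const (x := p) (s := Set.Iic 0) (c := ThetaBox n 0 t)).congr_of_mem
        (fun q hq => ThetaBox_of_nonpos n hq t) hp
    exact (uniqueDiffOn_Iic 0 p hp).eq_deriv _ h1 h2
  · exact deriv_zero_of_not_differentiableAt hd
/-! ## §3 Names used downstream: the vertical column, Russo weights, directions, axis permutations -/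

namespace Column

/-- The sites `k e₃`, `k ≤ n`, lie in `Λ_n`. [folklore] -/
theorem single_mem_box {n k : ℕ} (hk : k ≤ n) :
    (Pi.single (2 : Fin 3) (k : ℤ) : Site 3) ∈ box 3 n := by
  rw [mem_box]
  intro i
  by_cases hi : i = 2
  · subst hi
    simp only [Pi.single_eq_same]
    omega
  · simp only [Pi.single_apply, if_neg hi]
    omega

/-- `n e₃ ∈ ∂Λ_n`. [folklore] -/
theorem single_mem_innerBoundary (n : ℕ) :
    (Pi.single (2 : Fin 3) (n : ℤ) : Site 3) ∈ innerBoundary (zdGraph 3) (box 3 n) :=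
  mem_innerBoundary_box_of_natAbs_eq (single_mem_box le_rfl) (i := 2) (by simp)

/-- Consecutive sites `k e₃ ∼ (k+1) e₃` of the column are neighbours in `ℤ³`. [folklore] -/
theorem single_adj_single_succ (k : ℕ) :
    (zdGraph 3).Adj (Pi.single (2 : Fin 3) (k : ℤ) : Site 3)
      (Pi.single (2 : Fin 3) ((k + 1 : ℕ) : ℤ)) :=
  (zdGraph_adj_iff _ _).2
    ⟨2, Or.inl (by push_cast; exact Pi.single_add (f := fun _ : Fin 3 => ℤ) 2 (k : ℤ) 1)⟩

/-- The column bonds `s(k e₃, (k+1) e₃)` are lattice edges. [folklore] -/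
theorem bond_mem_edgeSet (k : ℕ) :
    s((Pi.single (2 : Fin 3) (k : ℤ) : Site 3), Pi.single (2 : Fin 3) ((k + 1 : ℕ) : ℤ)) ∈
      (zdGraph 3).edgeSet :=
  (SimpleGraph.mem_edgeSet _).2 (single_adj_single_succ k)

/-- The column bonds are vertical. [folklore] -/
theorem isVert_bond (k : ℕ) :
    s((Pi.single (2 : Fin 3) (k : ℤ) : Site 3), Pi.single (2 : Fin 3) ((k + 1 : ℕ) : ℤ)) ∈ vertBonds := by
  refine ⟨Pi.single (2 : Fin 3) (k : ℤ), ?_⟩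
  push_cast
  rw [← Pi.single_add (f := fun _ : Fin 3 => ℤ) 2 (k : ℤ) 1]

/-- The column bonds `s(k e₃, (k+1) e₃)`, `k ≥ 1`, avoid the origin. [folklore] -/
theorem zero_notMem_bond {k : ℕ} (hk : 1 ≤ k) :
    (0 : Site 3) ∉
      s((Pi.single (2 : Fin 3) (k : ℤ) : Site 3), Pi.single (2 : Fin 3) ((k + 1 : ℕ) : ℤ)) := by
  rw [Sym2.mem_iff]
  rintro (h | h) <;> have h0 := congr_fun h 2 <;>
    simp only [Pi.single_eq_same, Pi.zero_apply] at h0 <;> omega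

/-- The first vertical bond `e_z = s(0, e₃)`. [folklore] -/
def ez : Sym2 (Site 3) := s((0 : Site 3), Pi.single (2 : Fin 3) 1)

/-- `e_z` is a lattice edge. [folklore] -/
theorem ez_mem_edgeSet : ez ∈ (zdGraph 3).edgeSet := by
  rw [ez, SimpleGraph.mem_edgeSet, zdGraph_adj_iff]
  exact ⟨2, Or.inl (by simp)⟩

/-- `e_z` is vertical. [folklore] -/
theorem isVert_ez : ez ∈ vertBonds := ⟨0, by simp [ez]⟩

/-- `e_z` is a pair of sites of `Λ_n` for `n ≥ 1` (the guard `1 ≤ n` enters here). [folklore] -/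
theorem ez_mem_sym2_box {n : ℕ} (hn : 1 ≤ n) : ez ∈ (box 3 n).sym2 := by
  rw [ez, Finset.mk_mem_sym2_iff]
  refine ⟨zero_mem_box 3 n, ?_⟩
  have h := single_mem_box (n := n) (k := 1) hn
  rwa [Nat.cast_one] at h

/-- The column above `e₃`: the bonds `s(k e₃, (k+1) e₃)`, `1 ≤ k < n`. [folklore] -/
def colT (n : ℕ) : Set (Sym2 (Site 3)) :=
  {e | ∃ k : ℕ, 1 ≤ k ∧ k < n ∧
    e = s((Pi.single (2 : Fin 3) (k : ℤ) : Site 3), Pi.single (2 : Fin 3) ((k + 1 : ℕ) : ℤ))}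

/-- `e_z` is not a bond of the column above `e₃`. [folklore] -/
theorem ez_notMem_colT (n : ℕ) : ez ∉ colT n := by
  rintro ⟨k, hk1, -, hk⟩
  refine zero_notMem_bond hk1 ?_
  rw [← hk]
  exact Sym2.mem_mk_left _ _

end Column

open Classical in
/-- The coordinate derivatives of the path `s ↦ param p s`: `1` on vertical lattice edges,
`0` elsewhere. [folklore] -/
def wz (e : Sym2 (Site 3)) : ℝ := if e ∈ (zdGraph 3).edgeSet ∧ e ∈ vertBonds then 1 else 0

/-- Weight `1` on vertical lattice edges. [folklore] -/
theorem wz_of_vert {e : Sym2 (Site 3)} (he : e ∈ (zdGraph 3).edgeSet) (hv : e ∈ vertBonds) : wz e = 1 := by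
  simp only [wz]
  rw [if_pos ⟨he, hv⟩]

/-- Weight `0` on non-vertical pairs. [folklore] -/
theorem wz_of_not_vert {e : Sym2 (Site 3)} (hv : e ∉ vertBonds) : wz e = 0 := by
  simp only [wz]
  rw [if_neg fun h => hv h.2]

/-- Weight `0` off the edge set. [folklore] -/
theorem wz_of_not_mem {e : Sym2 (Site 3)} (he : e ∉ (zdGraph 3).edgeSet) : wz e = 0 := by
  simp only [wz]
  rw [if_neg fun h => he h.1]

/-- The weights are nonnegative. [folklore] -/
theorem wz_nonneg (e : Sym2 (Site 3)) : 0 ≤ wz e := by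
  simp only [wz]
  split_ifs <;> norm_num

namespace Diag

/-- The bonds of direction `i`: `{x, x + eᵢ}`. [folklore] -/
def dirBonds (i : Fin 3) : Set (Sym2 (Site 3)) := {e | ∃ x : Site 3, e = s(x, x + Pi.single i 1)}

/-- The vertical bonds are the bonds of direction `2`. [folklore] -/
theorem vertBonds_eq : vertBonds = dirBonds 2 := rfl

open Classical in
/-- Directional Russo weights: `1` on lattice edges of direction `i`, `0` elsewhere. [folklore] -/
def wdir (i : Fin 3) (e : Sym2 (Site 3)) : ℝ :=
  if e ∈ (zdGraph 3).edgeSet ∧ e ∈ dirBonds i then 1 else 0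

/-- The vertical weights are the direction-`2` weights. [folklore] -/
theorem wz_eq_wdir : wz = wdir 2 := rfl

open Classical in
/-- Horizontal Russo weights: `1` on non-vertical lattice edges, `0` elsewhere. [folklore] -/
def wh (e : Sym2 (Site 3)) : ℝ := if e ∈ (zdGraph 3).edgeSet ∧ e ∉ vertBonds then 1 else 0

/-- The coordinate permutation `x ↦ x ∘ π⁻¹` (no signs) as an automorphism of `ℤ³`. [folklore] -/
def permIso (π : Equiv.Perm (Fin 3)) : zdGraph 3 ≃g zdGraph 3 := zdSignedPermIso π 1

/-- `permIso π` acts by the unsigned coordinate permutation. [folklore] -/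
theorem permIso_apply (π : Equiv.Perm (Fin 3)) (x : Site 3) :
    permIso π x = Site.signedPerm π 1 x := rfl

/-- Unsigned permutations map `eⱼ` to `e_{π j}`. [folklore] -/
theorem signedPerm_one_single (π : Equiv.Perm (Fin 3)) (j : Fin 3) :
    Site.signedPerm π 1 (Pi.single j (1 : ℤ)) = Pi.single (π j) 1 := by
  rw [Site.signedPerm_single]
  simp

/-- The induced bijection of pairs. [folklore] -/
abbrev pairPerm (π : Equiv.Perm (Fin 3)) : Sym2 (Site 3) ≃ Sym2 (Site 3) :=
  sym2Equiv (permIso π).toEquiv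

end Diag

end Summit.CriticalPhenomena.PercolationContinuityZ3.Theorems.SubcritExchangeUniformity.Negative

end
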